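import Literature.Geometry.Riemannian.TensionFieldRegularity
import Literature.Geometry.Lorentzian.LeviCivitaProofs
import HarnessLib

/-!
# The tension field is a smooth field along the map (Eells–Ratto 1993, Ch. I (1.7))
(topic `Geometry/Riemannian`)

Eells–Ratto 1993, Ch. I (1.7): "The tension field of `φ : (M,g) → (N,h)` is `τ(φ) = Trace_g ∇dφ`
… `τ(φ) ∈ 𝒞(φ⁻¹T(N))`" — a (smooth) section of the pull-back bundle. With the definitions of
`TensionField.lean` and the frame independence `tensionField_eq_sum_frame` of
`TensionFieldRegularity.lean` we PROVE, for a `C^∞` map `φ` (source modelled on a boundaryless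
model, target carrying a `C^∞` pseudo-Riemannian metric with its Levi-Civita connection):

* `contMDiffAt_lift_add/smul/sub/sum`, `contMDiffAt_localFrame_coeff_lift` — algebra and frame
  coefficients of `C^∞` maps `x ↦ (b x, A x) ∈ TN` along a base map `b` (sections of `b⁻¹TN`);
* `contMDiffAt_lift_normalDerivAlong` — **`x ↦ D_{Z x} ν` is `C^∞` along `φ`** for a field `ν`
  along `φ` with `C^∞` lift and a `C^∞` vector field `Z` (fixed-frame formula
  `normalDerivAlong_eq_frame` + smoothness of the Levi-Civita connection);
* `contMDiffAt_lift_secondFF` — `x ↦ ∇dφ(Z x, Y)(x)` is `C^∞` along `φ`;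
* `contMDiff_lift_tensionField` — **`x ↦ (φ x, τ(φ)(x)) ∈ TN` is `C^∞`**, with the continuity
  and the smoothness of the pairings `x ↦ h(τ(φ)(x), V x)` as corollaries.

Everything is proved; there are no definitions and no named facts.

## References

* J. Eells, A. Ratto, *Harmonic Maps and Minimal Immersions with Symmetries*, Ann. of Math.
  Studies 130 (1993), Ch. I, (1.5), (1.7). Held copy, PDF pp. 13–14. [EellsRatto1993]
* B. O'Neill, *Semi-Riemannian Geometry* (1983), Ch. 3, Prop. 3.18; Ch. 4, Lemma 1. [ONeill1983]
-/

noncomputable section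

open Bundle Set Function Filter
open scoped Manifold ContDiff Topology

namespace Literature.Geometry.Riemannian

open Lorentzian Lorentzian.PseudoRiemannianMetric

namespace HarmonicMap

/-! ### Algebra of smooth maps into the tangent bundle along a base map -/

section LiftAlgebra

variable {EX : Type*} [NormedAddCommGroup EX] [NormedSpace ℝ EX] {HX : Type*} [TopologicalSpace HX]
  {J : ModelWithCorners ℝ EX HX} {X : Type*} [TopologicalSpace X] [ChartedSpace HX X]
  {EN : Type*} [NormedAddCommGroup EN] [NormedSpace ℝ EN] {HN : Type*} [TopologicalSpace HN]
  {IN : ModelWithCorners ℝ EN HN} {N : Type*} [TopologicalSpace N] [ChartedSpace HN N]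
  [IsManifold IN ∞ N] {b : X → N} {x : X}

/-- **Fibre coordinates of a smooth map into `TN` along a base map.** If `x ↦ (b x, A x) ∈ TN` is
`C^∞` at `x₀`, then so is its fibre coordinate `x ↦ (Tr (b x, A x)).2` in the trivialisation `Tr`
of `TN` at `b x₀`, and conversely together with smoothness of `b` (Mathlib's
`Trivialization.contMDiffAt_iff`). [folklore] -/
theorem contMDiffAt_lift_iff {A : Π x : X, TangentSpace IN (b x)} :
    ContMDiffAt J IN.tangent ∞ (fun x ↦ (TotalSpace.mk' EN (b x) (A x) : TangentBundle IN N)) x ↔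
      ContMDiffAt J IN ∞ b x ∧ ContMDiffAt J 𝓘(ℝ, EN) ∞ (fun x' ↦
        ((trivializationAt EN (TangentSpace IN : N → Type _) (b x))
          (TotalSpace.mk' EN (b x') (A x') : TangentBundle IN N)).2) x := by
  have hsrc : (TotalSpace.mk' EN (b x) (A x) : TangentBundle IN N) ∈
      (trivializationAt EN (TangentSpace IN : N → Type _) (b x)).source := by
    rw [Trivialization.mem_source]; exact FiberBundle.mem_baseSet_trivializationAt' (b x)
  exact (trivializationAt EN (TangentSpace IN : N → Type _) (b x)).contMDiffAt_iff
    (f := fun x' ↦ (TotalSpace.mk' EN (b x') (A x') : TangentBundle IN N)) hsrc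

/-- **Sum of smooth maps into `TN` along the same base map** is smooth (fibre coordinates add in
the trivialisation at the base point). [folklore] -/
theorem contMDiffAt_lift_add {A B : Π x : X, TangentSpace IN (b x)}
    (hA : ContMDiffAt J IN.tangent ∞ (fun x ↦ (TotalSpace.mk' EN (b x) (A x) : TangentBundle IN N)) x)
    (hB : ContMDiffAt J IN.tangent ∞ (fun x ↦ (TotalSpace.mk' EN (b x) (B x) : TangentBundle IN N)) x) :
    ContMDiffAt J IN.tangent ∞
      (fun x ↦ (TotalSpace.mk' EN (b x) (A x + B x) : TangentBundle IN N)) x := by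
  obtain ⟨hb, hAc⟩ := contMDiffAt_lift_iff.1 hA
  obtain ⟨-, hBc⟩ := contMDiffAt_lift_iff.1 hB
  refine contMDiffAt_lift_iff.2 ⟨hb, ?_⟩
  have hnear : ∀ᶠ x' in 𝓝 x, b x' ∈
      (trivializationAt EN (TangentSpace IN : N → Type _) (b x)).baseSet :=
    hb.continuousAt.preimage_mem_nhds
      ((trivializationAt EN (TangentSpace IN : N → Type _) (b x)).open_baseSet.mem_nhds
        (FiberBundle.mem_baseSet_trivializationAt' (b x)))
  refine (hAc.add hBc).congr_of_eventuallyEq ?_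
  filter_upwards [hnear] with x' hx'
  simp only [Pi.add_apply]
  rw [← Trivialization.continuousLinearMapAt_apply_of_mem ℝ _ hx',
    ← Trivialization.continuousLinearMapAt_apply_of_mem ℝ _ hx',
    ← Trivialization.continuousLinearMapAt_apply_of_mem ℝ _ hx', map_add]

/-- **Rescaling a smooth map into `TN` along a base map by a smooth function** is smooth
(`contMDiffAt_lift_smul` of `IMCFRegularity.lean`, restated for maps from a manifold). [folklore] -/
theorem contMDiffAt_lift_smul {A : Π x : X, TangentSpace IN (b x)} {c : X → ℝ}
    (hA : ContMDiffAt J IN.tangent ∞ (fun x ↦ (TotalSpace.mk' EN (b x) (A x) : TangentBundle IN N)) x)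
    (hc : ContMDiffAt J 𝓘(ℝ, ℝ) ∞ c x) :
    ContMDiffAt J IN.tangent ∞
      (fun x ↦ (TotalSpace.mk' EN (b x) (c x • A x) : TangentBundle IN N)) x := by
  obtain ⟨hb, hAc⟩ := contMDiffAt_lift_iff.1 hA
  refine contMDiffAt_lift_iff.2 ⟨hb, ?_⟩
  have hnear : ∀ᶠ x' in 𝓝 x, b x' ∈
      (trivializationAt EN (TangentSpace IN : N → Type _) (b x)).baseSet :=
    hb.continuousAt.preimage_mem_nhds
      ((trivializationAt EN (TangentSpace IN : N → Type _) (b x)).open_baseSet.mem_nhds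
        (FiberBundle.mem_baseSet_trivializationAt' (b x)))
  refine (hc.smul hAc).congr_of_eventuallyEq ?_
  filter_upwards [hnear] with x' hx'
  simp only [Pi.smul_apply']
  rw [← Trivialization.continuousLinearMapAt_apply_of_mem ℝ _ hx',
    ← Trivialization.continuousLinearMapAt_apply_of_mem ℝ _ hx', map_smul]

/-- **Difference of smooth maps into `TN` along the same base map** is smooth. [folklore] -/
theorem contMDiffAt_lift_sub {A B : Π x : X, TangentSpace IN (b x)}
    (hA : ContMDiffAt J IN.tangent ∞ (fun x ↦ (TotalSpace.mk' EN (b x) (A x) : TangentBundle IN N)) x)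
    (hB : ContMDiffAt J IN.tangent ∞ (fun x ↦ (TotalSpace.mk' EN (b x) (B x) : TangentBundle IN N)) x) :
    ContMDiffAt J IN.tangent ∞
      (fun x ↦ (TotalSpace.mk' EN (b x) (A x - B x) : TangentBundle IN N)) x := by
  have hB' := contMDiffAt_lift_smul hB (contMDiffAt_const (c := (-1 : ℝ)))
  have := contMDiffAt_lift_add hA hB'
  simp only [neg_one_smul, ← sub_eq_add_neg] at this
  exact this

/-- **Finite sums of smooth maps into `TN` along the same base map** are smooth. [folklore] -/
theorem contMDiffAt_lift_sum {ι : Type*} (s : Finset ι) {A : ι → Π x : X, TangentSpace IN (b x)}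
    (hb : ContMDiffAt J IN ∞ b x)
    (hA : ∀ i ∈ s, ContMDiffAt J IN.tangent ∞
      (fun x ↦ (TotalSpace.mk' EN (b x) (A i x) : TangentBundle IN N)) x) :
    ContMDiffAt J IN.tangent ∞
      (fun x ↦ (TotalSpace.mk' EN (b x) (∑ i ∈ s, A i x) : TangentBundle IN N)) x := by
  classical
  induction s using Finset.induction_on with
  | empty =>
    simp only [Finset.sum_empty]
    refine contMDiffAt_lift_iff.2 ⟨hb, ?_⟩
    have hnear : ∀ᶠ x' in 𝓝 x, b x' ∈
        (trivializationAt EN (TangentSpace IN : N → Type _) (b x)).baseSet :=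
      hb.continuousAt.preimage_mem_nhds
        ((trivializationAt EN (TangentSpace IN : N → Type _) (b x)).open_baseSet.mem_nhds
          (FiberBundle.mem_baseSet_trivializationAt' (b x)))
    refine (contMDiffAt_const (c := (0 : EN))).congr_of_eventuallyEq ?_
    filter_upwards [hnear] with x' hx'
    rw [← Trivialization.continuousLinearMapAt_apply_of_mem ℝ _ hx', map_zero]
  | @insert i s hi ih =>
    simp only [Finset.sum_insert hi]
    exact contMDiffAt_lift_add (hA i (Finset.mem_insert_self i s))
      (ih fun j hj ↦ hA j (Finset.mem_insert_of_mem hj))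

/-- **Local-frame coefficients of a smooth map into `TN` along a base map are smooth**: for a
trivialisation `Tr` of the atlas of `TN` with `b x ∈ Tr.baseSet` and a basis of the model fibre,
`x' ↦ Tr.localFrame_coeff IN bN i (b x') (A x')` is `C^∞` at `x` (it is the `i`-th coordinate of
the fibre coordinate of the lift near `x`). [folklore] -/
theorem contMDiffAt_localFrame_coeff_lift [FiniteDimensional ℝ EN] {ι : Type*}
    (bN : Module.Basis ι ℝ EN)
    (Tr : Trivialization EN (TotalSpace.proj : TangentBundle IN N → N)) [MemTrivializationAtlas Tr]
    {A : Π x : X, TangentSpace IN (b x)} (hx : b x ∈ Tr.baseSet)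
    (hA : ContMDiffAt J IN.tangent ∞ (fun x ↦ (TotalSpace.mk' EN (b x) (A x) : TangentBundle IN N)) x)
    (i : ι) :
    ContMDiffAt J 𝓘(ℝ, ℝ) ∞ (fun x' ↦ Tr.localFrame_coeff IN bN i (b x') (A x')) x := by
  have hb : ContMDiffAt J IN ∞ b x := (contMDiffAt_lift_iff.1 hA).1
  have hsrc : (TotalSpace.mk' EN (b x) (A x) : TangentBundle IN N) ∈ Tr.source := by
    rw [Trivialization.mem_source]; exact hx
  have hAc := ((Tr.contMDiffAt_iff
    (f := fun x' ↦ (TotalSpace.mk' EN (b x') (A x') : TangentBundle IN N)) hsrc).1 hA).2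
  have h1 : ContMDiffAt J 𝓘(ℝ, ℝ) ∞
      (fun x' ↦ bN.coord i (Tr (TotalSpace.mk' EN (b x') (A x') : TangentBundle IN N)).2) x :=
    (LinearMap.toContinuousLinearMap (bN.coord i)).contMDiff.contMDiffAt.comp x hAc
  have hnear : ∀ᶠ x' in 𝓝 x, b x' ∈ Tr.baseSet :=
    hb.continuousAt.preimage_mem_nhds (Tr.open_baseSet.mem_nhds hx)
  refine h1.congr_of_eventuallyEq ?_
  filter_upwards [hnear] with x' hx'
  rw [Tr.localFrame_coeff_eq_coeff (b := bN) (s := fun _ ↦ A x') hx']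
  simp

end LiftAlgebra

/-! ### Smoothness of `x ↦ D_{Z x} ν` for smooth data -/

section Smoothness

variable {EM : Type*} [NormedAddCommGroup EM] [NormedSpace ℝ EM] [FiniteDimensional ℝ EM]
  {HM : Type*} [TopologicalSpace HM] {IM : ModelWithCorners ℝ EM HM}
  [IM.Boundaryless] {M : Type*} [TopologicalSpace M] [ChartedSpace HM M] [IsManifold IM ∞ M]
  {EN : Type*} [NormedAddCommGroup EN] [NormedSpace ℝ EN] [FiniteDimensional ℝ EN]
  [CompleteSpace EN] {HN : Type*} [TopologicalSpace HN] {IN : ModelWithCorners ℝ EN HN}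
  {N : Type*} [TopologicalSpace N] [ChartedSpace HN N] [IsManifold IN ∞ N]

variable (h : PseudoRiemannianMetric IN ∞ EN (TangentSpace IN : N → Type _)) [h.HasLeviCivita]
  {φ : M → N} (hφ : ContMDiff IM IN ∞ φ)

include hφ in
omit [FiniteDimensional ℝ EM] in
/-- **`x ↦ D_{Z(x)} ν` is a smooth field along `φ`** when `φ` is `C^∞`, the field `ν` along `φ` has
`C^∞` lift near `x₀` and the vector field `Z` of `M` is `C^∞` near `x₀`: by the fixed-frame
formula `normalDerivAlong_eq_frame` (frame of `TN` at `φ x₀`),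
`D_{Z x} ν = ∑ᵢ d(νⁱ)_x(Z x) tᵢ(φ x) + ∑ᵢ νⁱ(x) ∇_{dφ(Z x)} tᵢ` near `x₀`, and every term is a
`C^∞` map into `TN` along `φ` (`contMDiffAt_localFrame_coeff_lift`,
`contMDiffAt_mvfderiv_apply_of_le`, smoothness of the Levi-Civita connection
`isLocallyContMDiff_leviCivita_holds` with `ContMDiffAt.clm_bundle_apply`, and the lift algebra
above). O'Neill 1983, Ch. 4, Lemma 1 and Prop. 3.18. [cite: ONeill1983, Ch. 4, Lemma 1] -/
theorem contMDiffAt_lift_normalDerivAlong {ν : Π y : M, TangentSpace IN (φ y)} {x₀ : M}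
    (hν : ∀ᶠ x in 𝓝 x₀, ContMDiffAt IM IN.tangent ∞
      (fun y ↦ (TotalSpace.mk' EN (φ y) (ν y) : TangentBundle IN N)) x)
    {Z : Π y : M, TangentSpace IM y} (hZ : ∀ᶠ x in 𝓝 x₀, CMDiffAt ∞ (T% Z) x) :
    ContMDiffAt IM IN.tangent ∞ (fun x ↦ (TotalSpace.mk' EN (φ x)
      (h.normalDerivAlong φ ν x (Z x)) : TangentBundle IN N)) x₀ := by
  classical
  set x₁ := φ x₀ with hx₁
  set bN := Module.finBasis ℝ EN with hbN
  set Tr := trivializationAt EN (TangentSpace IN : N → Type _) x₁ with hTr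
  have htop : (((⊤ : ℕ∞) : ℕ∞ω)) = ∞ := rfl
  have hinf : h.leviCivita.IsLocallyContMDiff (⊤ : ℕ∞) :=
    h.isLocallyContMDiff_leviCivita_holds ⊤ (by simp)
  have hbase : Tr.baseSet = (chartAt HN x₁).source := by rw [hTr]; rfl
  have hx₁T : x₁ ∈ Tr.baseSet := FiberBundle.mem_baseSet_trivializationAt' x₁
  -- the frame of `TN` at `x₁` and its covariant derivatives are smooth on the chart domain
  have ht : ∀ i, CMDiff[Tr.baseSet] ∞ (T% (Tr.localFrame bN i)) := fun i y hy ↦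
    (contMDiffAt_localFrame_of_mem ∞ Tr bN i hy).contMDiffWithinAt
  have hDt : ∀ i, ContMDiffOn IN (IN.prod 𝓘(ℝ, EN →L[ℝ] EN)) ∞
      (h.leviCivita.totalCovDeriv (Tr.localFrame bN i)) Tr.baseSet := fun i ↦
    (hinf Tr.baseSet Tr.open_baseSet).contMDiff (by simpa [htop] using ht i)
  -- near `x₀`: `φ x ∈ Tr.baseSet`, the lift of `ν` and `Z` are smooth
  have hnear : ∀ᶠ x in 𝓝 x₀, φ x ∈ Tr.baseSet :=
    hφ.continuous.continuousAt.preimage_mem_nhds (Tr.open_baseSet.mem_nhds hx₁T)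
  -- coefficient functions `νⁱ`
  set c : Fin (Module.finrank ℝ EN) → M → ℝ := fun i x ↦ Tr.localFrame_coeff IN bN i (φ x) (ν x)
    with hc
  have hcs : ∀ i, ∀ᶠ x in 𝓝 x₀, ContMDiffAt IM 𝓘(ℝ, ℝ) ∞ (c i) x := fun i ↦ by
    filter_upwards [hnear, hν] with x hx hνx
    exact contMDiffAt_localFrame_coeff_lift bN Tr hx hνx i
  -- the frame formula, eventually near `x₀`
  have hformula : ∀ᶠ x in 𝓝 x₀, h.normalDerivAlong φ ν x (Z x) =
      ∑ i, (show ℝ from mfderiv IM 𝓘(ℝ, ℝ) (c i) x (Z x)) • Tr.localFrame bN i (φ x) +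
        ∑ i, c i x • h.leviCivita (Tr.localFrame bN i) (φ x) (mfderiv IM IN φ x (Z x)) := by
    filter_upwards [hnear, hν] with x hx hνx
    have h1 : φ x ∈ (chartAt HN x₁).source := hbase ▸ hx
    exact normalDerivAlong_eq_frame h bN (f := φ) (x₁ := x₁) h1
      BoundarylessManifold.isInteriorPoint (hνx.mdifferentiableAt (by simp)) (Z x)
  -- smoothness of the right-hand side
  have hZ₀ : CMDiffAt ∞ (T% Z) x₀ := hZ.self_of_nhds
  have hterm1 : ∀ i, ContMDiffAt IM IN.tangent ∞ (fun x ↦ (TotalSpace.mk' EN (φ x)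
      ((show ℝ from mfderiv IM 𝓘(ℝ, ℝ) (c i) x (Z x)) • Tr.localFrame bN i (φ x)) :
        TangentBundle IN N)) x₀ := by
    intro i
    refine contMDiffAt_lift_smul ?_ ?_
    · exact (contMDiffAt_localFrame_of_mem ∞ Tr bN i hx₁T).comp x₀ (hφ x₀)
    · have hci : ContMDiffAt IM 𝓘(ℝ, ℝ) (∞ + 1) (c i) x₀ := by
        have : ContMDiffAt IM 𝓘(ℝ, ℝ) ∞ (c i) x₀ := (hcs i).self_of_nhds
        -- `C^∞` on a neighbourhood gives `C^{∞+1} = C^∞`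
        simpa using this
      exact contMDiffAt_mvfderiv_apply_of_le hci hZ₀
  have hdφZ : ContMDiffAt IM IN.tangent ∞ (fun x ↦ (TotalSpace.mk' EN (φ x)
      (mfderiv IM IN φ x (Z x)) : TangentBundle IN N)) x₀ :=
    (hφ.contMDiff_tangentMap (le_of_eq rfl)).contMDiffAt.comp x₀ hZ₀
  have hterm2 : ∀ i, ContMDiffAt IM IN.tangent ∞ (fun x ↦ (TotalSpace.mk' EN (φ x)
      (c i x • h.leviCivita (Tr.localFrame bN i) (φ x) (mfderiv IM IN φ x (Z x))) :
        TangentBundle IN N)) x₀ := by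
    intro i
    refine contMDiffAt_lift_smul ?_ (hcs i).self_of_nhds
    have hD : ContMDiffAt IM (IN.prod 𝓘(ℝ, EN →L[ℝ] EN)) ∞
        (fun x ↦ h.leviCivita.totalCovDeriv (Tr.localFrame bN i) (φ x)) x₀ :=
      ((hDt i).contMDiffAt (Tr.open_baseSet.mem_nhds hx₁T)).comp x₀ (hφ x₀)
    exact ContMDiffAt.clm_bundle_apply (b := φ) hD hdφZ
  have hrhs : ContMDiffAt IM IN.tangent ∞ (fun x ↦ (TotalSpace.mk' EN (φ x)
      (∑ i, (show ℝ from mfderiv IM 𝓘(ℝ, ℝ) (c i) x (Z x)) • Tr.localFrame bN i (φ x) +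
        ∑ i, c i x • h.leviCivita (Tr.localFrame bN i) (φ x) (mfderiv IM IN φ x (Z x))) :
        TangentBundle IN N)) x₀ :=
    contMDiffAt_lift_add (contMDiffAt_lift_sum _ (hφ x₀) fun i _ ↦ hterm1 i)
      (contMDiffAt_lift_sum _ (hφ x₀) fun i _ ↦ hterm2 i)
  refine hrhs.congr_of_eventuallyEq ?_
  filter_upwards [hformula] with x hx
  rw [hx]

variable [CompleteSpace EM] (g : ContMDiffRiemannianMetric IM ∞ EM (TangentSpace IM : M → Type _))
  [(ofRiemannian g).HasLeviCivita]

include hφ in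
/-- **`x ↦ ∇dφ(Z x, Y)(x)` is a smooth field along `φ`** for `C^∞` `φ` and vector fields `Z, Y`
`C^∞` near `x₀` (`contMDiffAt_lift_normalDerivAlong` for `ν = dφ(Y)`, smoothness of `∇^M_Z Y`
and of the tangent map). Eells–Ratto 1993, Ch. I (1.5). [cite: EellsRatto1993, Ch. I (1.5)] -/
theorem contMDiffAt_lift_secondFF {Z Y : Π y : M, TangentSpace IM y} {x₀ : M}
    (hZ : ∀ᶠ x in 𝓝 x₀, CMDiffAt ∞ (T% Z) x) (hY : ∀ᶠ x in 𝓝 x₀, CMDiffAt ∞ (T% Y) x) :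
    ContMDiffAt IM IN.tangent ∞ (fun x ↦ (TotalSpace.mk' EN (φ x)
      (secondFF g h φ x (Z x) Y) : TangentBundle IN N)) x₀ := by
  have htop : (((⊤ : ℕ∞) : ℕ∞ω)) = ∞ := rfl
  have hinfM : (ofRiemannian g).leviCivita.IsLocallyContMDiff (⊤ : ℕ∞) :=
    (ofRiemannian g).isLocallyContMDiff_leviCivita_holds ⊤ (by simp)
  -- `D_{Z x}(dφ Y)` is smooth
  have hν : ∀ᶠ x in 𝓝 x₀, ContMDiffAt IM IN.tangent ∞
      (fun y ↦ (TotalSpace.mk' EN (φ y) (mfderiv IM IN φ y (Y y)) : TangentBundle IN N)) x := by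
    filter_upwards [hY] with x hYx
    exact (hφ.contMDiff_tangentMap (le_of_eq rfl)).contMDiffAt.comp x hYx
  have h1 := contMDiffAt_lift_normalDerivAlong h hφ hν hZ
  -- `dφ(∇_Z Y)` is smooth
  obtain ⟨U, hUY, hUo, hx₀U⟩ := eventually_nhds_iff.1 hY
  have hYU : CMDiff[U] ∞ (T% Y) := fun x hx ↦ (hUY x hx).contMDiffWithinAt
  have hDY : ContMDiffOn IM (IM.prod 𝓘(ℝ, EM →L[ℝ] EM)) ∞
      ((ofRiemannian g).leviCivita.totalCovDeriv Y) U :=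
    (hinfM U hUo).contMDiff (by simpa [htop] using hYU)
  have hW : CMDiffAt ∞ (T% (fun x ↦ (ofRiemannian g).leviCivita Y x (Z x))) x₀ :=
    ContMDiffAt.clm_bundle_apply (b := id) (hDY.contMDiffAt (hUo.mem_nhds hx₀U)) hZ.self_of_nhds
  have h2 : ContMDiffAt IM IN.tangent ∞ (fun x ↦ (TotalSpace.mk' EN (φ x)
      (mfderiv IM IN φ x ((ofRiemannian g).leviCivita Y x (Z x))) : TangentBundle IN N)) x₀ :=
    (hφ.contMDiff_tangentMap (le_of_eq rfl)).contMDiffAt.comp x₀ hW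
  exact contMDiffAt_lift_sub h1 h2

include hφ in
/-- **The tension field of a smooth map is a smooth field along the map** (Eells–Ratto 1993,
Ch. I (1.7): `τ(φ) ∈ 𝒞(φ⁻¹T(N))`): `x ↦ (φ x, τ(φ)(x)) ∈ TN` is `C^∞`. Near each `x₀`, by frame
independence (`tensionField_eq_sum_frame`) `τ(φ)` is computed in the FIXED frame of the
trivialisation of `TM` at `x₀`, `τ(φ)(x) = ∑ₖₗ (𝒢(x)⁻¹)ₖₗ ∇dφ(sₖ x, sₗ)(x)`, whose terms are smooth
(`contMDiffAt_lift_secondFF`, `contMDiffOn_gram_localFrame_inv`).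
[cite: EellsRatto1993, Ch. I (1.7)] -/
theorem contMDiff_lift_tensionField :
    ContMDiff IM IN.tangent ∞ (fun x ↦ (TotalSpace.mk' EN (φ x) (tensionField g h φ x) :
      TangentBundle IN N)) := by
  classical
  intro x₀
  set e := trivializationAt EM (TangentSpace IM : M → Type _) x₀ with he
  set bE := Module.finBasis ℝ EM with hbE
  have hx₀e : x₀ ∈ e.baseSet := FiberBundle.mem_baseSet_trivializationAt' x₀
  have hnear : ∀ᶠ x in 𝓝 x₀, x ∈ e.baseSet := e.open_baseSet.mem_nhds hx₀e
  have hs : ∀ k, ∀ᶠ x in 𝓝 x₀, CMDiffAt ∞ (T% (e.localFrame bE k)) x := fun k ↦ by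
    filter_upwards [hnear] with x hx
    exact contMDiffAt_localFrame_of_mem ∞ e bE k hx
  have hrhs : ContMDiffAt IM IN.tangent ∞ (fun x ↦ (TotalSpace.mk' EN (φ x)
      (∑ k, ∑ l, (Matrix.of fun i j ↦ (ofRiemannian g).val x (e.localFrame bE i x)
        (e.localFrame bE j x))⁻¹ k l • secondFF g h φ x (e.localFrame bE k x) (e.localFrame bE l)) :
        TangentBundle IN N)) x₀ := by
    refine contMDiffAt_lift_sum _ (hφ x₀) fun k _ ↦ ?_
    refine contMDiffAt_lift_sum _ (hφ x₀) fun l _ ↦ ?_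
    refine contMDiffAt_lift_smul (contMDiffAt_lift_secondFF h hφ g (hs k) (hs l)) ?_
    exact (contMDiffOn_gram_localFrame_inv e (ofRiemannian g) bE k l x₀ hx₀e).contMDiffAt
      (e.open_baseSet.mem_nhds hx₀e)
  refine hrhs.congr_of_eventuallyEq ?_
  filter_upwards [hnear] with x hx
  rw [tensionField_eq_sum_frame g h hφ e bE hx]

include hφ in
/-- The tension field of a smooth map is a continuous map into `TN`. [cite: EellsRatto1993, Ch. I (1.7)] -/
theorem continuous_lift_tensionField :
    Continuous (fun x ↦ (TotalSpace.mk' EN (φ x) (tensionField g h φ x) : TangentBundle IN N)) :=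
  (contMDiff_lift_tensionField h hφ g).continuous

include hφ in
/-- **`x ↦ h(τ(φ)(x), V x)` is smooth** for every field `V` along `φ` with `C^∞` lift (pairing of
two smooth maps into `TN` over `φ`, `contMDiffAt_val_apply_along`). [cite: EellsRatto1993, Ch. I (1.7)] -/
theorem contMDiff_val_tensionField {V : Π y : M, TangentSpace IN (φ y)}
    (hV : ContMDiff IM IN.tangent ∞ (fun y ↦ (TotalSpace.mk' EN (φ y) (V y) : TangentBundle IN N))) :
    ContMDiff IM 𝓘(ℝ, ℝ) ∞ (fun x ↦ h.val (φ x) (tensionField g h φ x) (V x)) := fun x ↦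
  contMDiffAt_val_apply_along (g := h) le_rfl (contMDiff_lift_tensionField h hφ g x) (hV x)

end Smoothness

end HarmonicMap

end Literature.Geometry.Riemannian

end
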